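import Summits.ResolutionOfSingularities.ResolutionOfSingularities.Theorems.WallCutRun
import HarnessLib

/-!
# WallCutRun2 — decomp-res node «LossIsolation — second kernel file WallCutRun (lens-3 g25; critic rows 189/189c:
node CLEARED, this file landed at 0 as a tool)», tree file 2/3 of the node

Content VERBATIM from the decomp-res lens-3 g25 kernel file `HOME/decomp-res-lens-3/g25/WallCutRun.lean` (PIN
84202afa; imports the landed tree only, carries nothing); HOME = run/shared/lean/pub/decomp-res; critic
CRITIC-LEDGER rows 189/189c, landing order INBOX :1068 — provenance, critic text and the lens header in full in the
first file of the node, `WallCutRun`.  Namespace `…Theorems.WallCutRun`; `--supports stmt-ResolutionOfSingularities-27367`.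

## This file

Continuation 2/3 of `WallCutRun` (same namespace and sections of the node, cut at the tree's 400-line cap; section
variables / opens replayed): `section Run`, `section Generic`, `section Layer` — carries `run_horizon_ledger`,
`st_succ_F`, `translate_chartTransform_eq_sum`, `exists_source_of_mem_support_succ`, `degree_succ_le`,
`degree_lt_of_thin_succ`, `layer_bound`, `newMult_le_apply_of_mem_support_succ`, `coeff_add_mul_of_minimal`,
`exists_minimal_le`, `exists_minimal_add_le_of_mem_support_mul`, `translate_mul`,
`filter_le_of_mem_support_translate_monomial`, `filter_mem_support_translate_monomial`, `translate_finset_sum`,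
`ord_le_degree_of_mem_support`, `chartExponent_eq_add`, `chartTransform_eq_monomial_mul`, `psi_support`.

[WRITER NOTE (decomp-res writer g12): file split only (tree files ≤ 400 lines); namespace, sections, section
variables / opens and every declaration exactly as in the lens.]

(Sources: Hauser2010 (kangaroo points, oblique polynomials); HauserPerlega2019 §2; Moh1987; CossartPiltant2008 §2;
CossartJannsenSaito2020 Ch. 8; Hironaka2005 (order under permissible blow-up); Perlega2022 (residual order is not monotone).)
-/

open MvPolynomial
open Literature.AlgebraicGeometry.Resolution
open Literature.AlgebraicGeometry.Resolution.Hauser2010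
open Literature.AlgebraicGeometry.Resolution.PointBlowup
open Summit.ResolutionOfSingularities.ResolutionOfSingularities.Theorems.TightDefectClasses
open Summit.ResolutionOfSingularities.ResolutionOfSingularities.Theorems.TightDefectStrongWalks
open Summit.ResolutionOfSingularities.ResolutionOfSingularities.Theorems.ItineraryCutClasses
open Summit.ResolutionOfSingularities.ResolutionOfSingularities.Theorems.BoundaryLedger
open Summit.ResolutionOfSingularities.ResolutionOfSingularities.Theorems.ProximityCut

namespace Summit.ResolutionOfSingularities.ResolutionOfSingularities.Theorems.WallCutRun

section Run

variable {K : Type} [Field K] [DecidableEq K] {q : ℕ} {s₀ : State (Fin 3) K}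

/-- **(D6) IN LEDGER FORM (PROVED).**  Along `k` moves at the origin of chart `j` on a plateau of shade `s`, every
thin monomial `d` of `F_t`
has degree excess `|d| − ordZero F_t ≥ k·(σ* − σ_j(d))` with `σ* = s + |r_t off j|`, `σ_j(d) = |d off j|`:
`|d| + k·σ_j(d) ≥ ordZero F_t + k·σ*`. [new] [folklore] -/
theorem run_horizon_ledger (hroot : IsRoot q s₀) (W : ForcedWalk q s₀) {t k : ℕ} {j : Fin 3}
    (hrun : ∀ i, i < k → W.j (t + i) = j ∧ W.b (t + i) = 0) {s : ℕ}
    (hsh : ∀ i, i ≤ k → (W.st (t + i)).shade = (s : ℕ∞)) {o : ℕ} (ho : ordZero (W.st t).F = o)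
    {d : Fin 3 →₀ ℕ} (hd : d ∈ (W.st t).F.support) (hthin : (Finsupp.erase j d).degree < q) :
    o + k * (s + (Finsupp.erase j (W.st t).r).degree) ≤ d.degree + k * (Finsupp.erase j d).degree := by
  obtain ⟨o', ho', -⟩ := walk_nat hroot W (t + k)
  have h1 := run_horizon hroot W hrun hd hthin ho'
  have h2 := (run_order hroot W hrun hsh ho ho').2
  have h3 : k * (q - (Finsupp.erase j d).degree) + k * (Finsupp.erase j d).degree = k * q := by
    rw [← Nat.mul_add]
    congr 1
    omega
  omega

/-! ## A general (translated) move: sources of monomials, the thin-degree bound, the layer bound -/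

/-- The step formula. [folklore] -/
theorem st_succ_F (W : ForcedWalk q s₀) (t : ℕ) :
    (W.st (t + 1)).F = deletePthPowers q (PointBlowup.translate (W.b t) (chartTransform q (W.j t) (W.st t).F)) := by
  rw [W.st_succ]
  rfl

omit [DecidableEq K] in
/-- The translated chart transform, monomial by monomial. [folklore] -/
theorem translate_chartTransform_eq_sum (q : ℕ) (b : Fin 3 → K) (j : Fin 3) (F : MvPolynomial (Fin 3) K) :
    PointBlowup.translate b (chartTransform q j F) =
      ∑ d ∈ F.support, PointBlowup.translate b (monomial (chartExponent q j d) (coeff d F)) := by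
  unfold chartTransform PointBlowup.translate
  rw [map_sum]

/-- **SOURCES (PROVED).**  Every monomial `d'` of `F_{t+1}` comes from a monomial `d` of `F_t`: `d' ≤ d[j ↦ |d| −
q]` coordinatewise,
with equality in the chart coordinate `j = j_t` (the translation fixes `u_j`). [folklore] -/
theorem exists_source_of_mem_support_succ (W : ForcedWalk q s₀) (t : ℕ) {d' : Fin 3 →₀ ℕ}
    (hd' : d' ∈ (W.st (t + 1)).F.support) :
    ∃ d ∈ (W.st t).F.support, d' ≤ chartExponent q (W.j t) d ∧ d' (W.j t) = d.degree - q := by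
  classical
  have h0 : coeff d' (W.st (t + 1)).F ≠ 0 := mem_support_iff.mp hd'
  rw [st_succ_F, coeff_deletePthPowers] at h0
  by_cases hP : IsPthPowerExponent q d'
  · rw [if_pos hP] at h0
    exact absurd rfl h0
  · rw [if_neg hP, translate_chartTransform_eq_sum, coeff_sum] at h0
    obtain ⟨d, hd, hne⟩ := Finset.exists_ne_zero_of_sum_ne_zero h0
    refine ⟨d, hd, le_of_coeff_translate_monomial_ne_zero _ hne, ?_⟩
    rw [apply_eq_of_coeff_translate_monomial_ne_zero _ (W.onExc t) hne, chartExponent_self]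

/-- **DEGREE OF A MONOMIAL AFTER A MOVE (PROVED).**  `|d'| + q ≤ |d| + σ_j(d)` for the source `d` of `d'`. [folklore] -/
theorem degree_succ_le (hs : IsRoot q s₀) (W : ForcedWalk q s₀) (t : ℕ) {d' : Fin 3 →₀ ℕ}
    (hd' : d' ∈ (W.st (t + 1)).F.support) :
    ∃ d ∈ (W.st t).F.support, d' (W.j t) + q = d.degree ∧
      d'.degree + q ≤ d.degree + (Finsupp.erase (W.j t) d).degree ∧
      Finsupp.erase (W.j t) d' ≤ Finsupp.erase (W.j t) d := by
  obtain ⟨d, hd, hle, hj⟩ := exists_source_of_mem_support_succ W t hd'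
  have hqd : q ≤ d.degree := le_degree_of_mem_support hs W t hd
  have h1 := degree_chartExponent_add q (W.j t) hqd
  have h2 := degree_le_degree_of_le hle
  refine ⟨d, hd, by omega, by omega, ?_⟩
  have h3 : Finsupp.erase (W.j t) d' ≤ Finsupp.erase (W.j t) (chartExponent q (W.j t) d) := by
    intro i
    by_cases hij : i = W.j t
    · rw [hij, Finsupp.erase_same, Finsupp.erase_same]
    · rw [Finsupp.erase_ne hij, Finsupp.erase_ne hij]
      exact hle i
  rwa [chartExponent_erase] at h3

/-- **THE THIN-DEGREE BOUND (PROVED; soundness of the all-stage FAT test).**  After ANY move (chart `j_t`, any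
admissible translation),
a monomial of `F_{t+1}` that is thin for an axis `i ≠ j_t` INSIDE the newest wall (`σ_i(d') < q`) has degree `< 3q`
— whatever the degree
of `F_t`. [new] [folklore] -/
theorem degree_lt_of_thin_succ (hs : IsRoot q s₀) (W : ForcedWalk q s₀) (t : ℕ) {i : Fin 3} (hij : i ≠ W.j t)
    {d' : Fin 3 →₀ ℕ} (hd' : d' ∈ (W.st (t + 1)).F.support) (hthin : (Finsupp.erase i d').degree < q) :
    d'.degree + 1 < 3 * q := by
  obtain ⟨d, hd, hj, hdeg, -⟩ := degree_succ_le hs W t hd'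
  have h1 : d' (W.j t) ≤ (Finsupp.erase i d').degree := by
    have := Finsupp.le_degree (W.j t) (Finsupp.erase i d')
    rwa [Finsupp.erase_ne (Ne.symm hij)] at this
  have h2 := degree_erase_add d (W.j t)
  have h3 : (W.st t).r ≤ d := walk_r hs W t d hd
  omega

/-- **THE LAYER BOUND (PROVED).**  After any move, the off-`j_t` degree of a monomial `d'` of `F_{t+1}` is at most
`|r_t off j_t| + (d'_{j_t} + q − |r_t|)` = `|r_t off j_t| + s + a` on a plateau of shade `s`, `a = d'_{j_t} − m` the layer:
`σ_{j_t}(d') + |r_t| ≤ |r_t off j_t| + d'_{j_t} + q`. [new] [folklore] -/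
theorem layer_bound (hs : IsRoot q s₀) (W : ForcedWalk q s₀) (t : ℕ) {d' : Fin 3 →₀ ℕ}
    (hd' : d' ∈ (W.st (t + 1)).F.support) :
    (Finsupp.erase (W.j t) d').degree + (W.st t).r.degree ≤
      (Finsupp.erase (W.j t) (W.st t).r).degree + d' (W.j t) + q := by
  obtain ⟨d, hd, hj, -, her⟩ := degree_succ_le hs W t hd'
  have hrd : (W.st t).r ≤ d := walk_r hs W t d hd
  have h1 := degree_le_degree_of_le her
  have h2 := degree_erase_add d (W.j t)
  have h3 := degree_erase_add (W.st t).r (W.j t)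
  have h4 : (W.st t).r (W.j t) ≤ d (W.j t) := hrd (W.j t)
  have h5 := degree_le_degree_of_le hrd
  -- σ_j(d) - σ_j(r) ≤ |d| - |r|  ⇔  σ_j(d) + |r| ≤ σ_j(r) + |d|, from r_j ≤ d_j
  omega

/-- **EVERY MONOMIAL AFTER A MOVE LIES OVER THE NEW WALL: `m ≤ d'_{j_t}` (PROVED).** [folklore] -/
theorem newMult_le_apply_of_mem_support_succ (hs : IsRoot q s₀) (W : ForcedWalk q s₀) (t : ℕ) {o : ℕ}
    (ho : ordZero (W.st t).F = o) {d' : Fin 3 →₀ ℕ} (hd' : d' ∈ (W.st (t + 1)).F.support) :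
    o - q ≤ d' (W.j t) := by
  obtain ⟨d, hd, hj, -, -⟩ := degree_succ_le hs W t hd'
  have h1 : o ≤ d.degree := by
    by_contra hlt
    push Not at hlt
    refine (mem_support_iff.mp hd) (coeff_eq_zero_of_degree_lt_ordZero ?_)
    rw [ho]
    exact_mod_cast hlt
  omega

end Run

section Generic

variable {K : Type} [Field K] [DecidableEq K]

/-! ## The post-move LAYER STRUCTURE (any translation): lowest terms of products, the factorisation `u^A · Ψ̃`, sharp sources -/

/-- **LOWEST TERMS OF A PRODUCT (PROVED).**  If every monomial of `T` lies above `α₀` and `ψ₀` is a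
coordinatewise-minimal monomial of `Ψ`,
then the coefficient of `u^{α₀+ψ₀}` in `T·Ψ` is the product of the two coefficients. [folklore] -/
theorem coeff_add_mul_of_minimal (T Ψ : MvPolynomial (Fin 3) K) {α₀ ψ₀ : Fin 3 →₀ ℕ}
    (hT : ∀ α ∈ T.support, α₀ ≤ α) (hmin : ∀ ψ ∈ Ψ.support, ψ ≤ ψ₀ → ψ = ψ₀) :
    coeff (α₀ + ψ₀) (T * Ψ) = coeff α₀ T * coeff ψ₀ Ψ := by
  classical
  rw [coeff_mul, Finset.sum_eq_single (α₀, ψ₀)]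
  · rintro ⟨α, ψ⟩ hmem hne
    rw [Finset.HasAntidiagonal.mem_antidiagonal] at hmem
    by_cases hα : coeff α T = 0
    · rw [hα, zero_mul]
    by_cases hψ : coeff ψ Ψ = 0
    · rw [hψ, mul_zero]
    exfalso
    have hα0 : α₀ ≤ α := hT α (mem_support_iff.mpr hα)
    have hψle : ψ ≤ ψ₀ := by
      intro i
      have h1 := congrArg (fun f : Fin 3 →₀ ℕ => f i) hmem
      simp only [Finsupp.add_apply] at h1
      have h2 := hα0 i
      omega
    have hψeq : ψ = ψ₀ := hmin ψ (mem_support_iff.mpr hψ) hψle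
    have hαeq : α = α₀ := by
      rw [hψeq] at hmem
      exact add_right_cancel hmem
    exact hne (Prod.ext hαeq hψeq)
  · intro h
    exact (h (Finset.HasAntidiagonal.mem_antidiagonal.mpr rfl)).elim

omit [DecidableEq K] in
/-- Below every monomial of `Ψ` there is a coordinatewise-minimal one. [folklore] -/
theorem exists_minimal_le (Ψ : MvPolynomial (Fin 3) K) {ψ : Fin 3 →₀ ℕ} (hψ : ψ ∈ Ψ.support) :
    ∃ ψ₀ ∈ Ψ.support, ψ₀ ≤ ψ ∧ ∀ ψ' ∈ Ψ.support, ψ' ≤ ψ₀ → ψ' = ψ₀ := by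
  obtain ⟨ψ₀, hle, hmin⟩ := Finset.exists_le_minimal Ψ.support hψ
  exact ⟨ψ₀, hmin.1, hle, fun ψ' hψ' hle' => le_antisymm hle' (hmin.2 hψ' hle')⟩

omit [DecidableEq K] in
/-- Every monomial of a product lies above `α₀ + ψ₀` for some minimal monomial `ψ₀` of the second factor. [folklore] -/
theorem exists_minimal_add_le_of_mem_support_mul (T Ψ : MvPolynomial (Fin 3) K) {α₀ : Fin 3 →₀ ℕ}
    (hT : ∀ α ∈ T.support, α₀ ≤ α) {e : Fin 3 →₀ ℕ} (he : e ∈ (T * Ψ).support) :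
    ∃ ψ₀ ∈ Ψ.support, α₀ + ψ₀ ≤ e ∧ ∀ ψ' ∈ Ψ.support, ψ' ≤ ψ₀ → ψ' = ψ₀ := by
  classical
  have h1 := support_mul T Ψ he
  obtain ⟨α, hα, ψ, hψ, rfl⟩ := Finset.mem_add.mp h1
  obtain ⟨ψ₀, hψ₀, hle, hmin⟩ := exists_minimal_le Ψ hψ
  exact ⟨ψ₀, hψ₀, add_le_add (hT α hα) hle, hmin⟩

omit [DecidableEq K] in
/-- `translate` is multiplicative. [folklore] -/
theorem translate_mul (b : Fin 3 → K) (P Q : MvPolynomial (Fin 3) K) :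
    PointBlowup.translate b (P * Q) = PointBlowup.translate b P * PointBlowup.translate b Q := by
  unfold PointBlowup.translate
  rw [map_mul]

/-- The monomials of `translate b (u^A)` lie above `A|_{b = 0}`. [folklore] -/
theorem filter_le_of_mem_support_translate_monomial (b : Fin 3 → K) (A : Fin 3 →₀ ℕ) {α : Fin 3 →₀ ℕ}
    (hα : α ∈ (PointBlowup.translate b (monomial A (1 : K))).support) :
    Finsupp.filter (fun i => b i = 0) A ≤ α := by
  classical
  intro i
  rw [Finsupp.filter_apply]
  by_cases hb : b i = 0
  · rw [if_pos hb, apply_eq_of_coeff_translate_monomial_ne_zero b hb (mem_support_iff.mp hα)]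
  · rw [if_neg hb]
    exact Nat.zero_le _

/-- The lowest monomial `A|_{b = 0}` of `translate b (u^A)` is present (given some untranslated coordinate `j`). [folklore] -/
theorem filter_mem_support_translate_monomial (b : Fin 3 → K) {j : Fin 3} (hbj : b j = 0) (A : Fin 3 →₀ ℕ) :
    Finsupp.filter (fun i => b i = 0) A ∈ (PointBlowup.translate b (monomial A (1 : K))).support := by
  classical
  have hsupp : (monomial A (1 : K)).support = {A} := by
    rw [support_monomial, if_neg one_ne_zero]
  obtain ⟨E, hE, hEj, hEdeg⟩ := exists_mem_support_translate_layer b hbj (monomial A (1 : K)) A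
    (by intro e he; rw [hsupp, Finset.mem_singleton] at he; rw [he]) 0
    (by intro e he _; rw [hsupp, Finset.mem_singleton] at he; rw [he]; omega)
    ⟨A, by rw [hsupp, Finset.mem_singleton], rfl⟩
  have hle := filter_le_of_mem_support_translate_monomial b A hE
  have heq : Finsupp.filter (fun i => b i = 0) A = E := by
    obtain ⟨c, hc⟩ := exists_add_of_le hle
    have hc0 : c.degree = 0 := by
      have := congrArg Finsupp.degree hc
      rw [map_add] at this
      omega
    have : c = 0 := (Finsupp.degree_eq_zero_iff c).mp hc0
    rw [hc, this, add_zero]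
  rw [heq]
  exact hE

omit [DecidableEq K] in
/-- `translate` of a finite sum. [folklore] -/
theorem translate_finset_sum {ι : Type} (b : Fin 3 → K) (S : Finset ι) (f : ι → MvPolynomial (Fin 3) K) :
    PointBlowup.translate b (∑ x ∈ S, f x) = ∑ x ∈ S, PointBlowup.translate b (f x) := by
  unfold PointBlowup.translate
  rw [map_sum]

end Generic

section Layer

variable {K : Type} [Field K] [DecidableEq K] {q : ℕ} {s₀ : State (Fin 3) K}

/-- Order ≤ degree of every monomial. [folklore] -/
theorem ord_le_degree_of_mem_support (W : ForcedWalk q s₀) (t : ℕ) {o : ℕ} (ho : ordZero (W.st t).F = o)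
    {d : Fin 3 →₀ ℕ} (hd : d ∈ (W.st t).F.support) : o ≤ d.degree := by
  by_contra hlt
  push Not at hlt
  refine (mem_support_iff.mp hd) (coeff_eq_zero_of_degree_lt_ordZero ?_)
  rw [ho]
  exact_mod_cast hlt

/-- **THE EXPONENT IDENTITY (PROVED).**  For a monomial `d = r + g` of `F_t = u^r·G` (`|g| ≥ s`, `o = s + |r| ≥ q`):
`d[j ↦ |d| − q] = (r off j + (o − q)·e_j) + g[j ↦ |g| − s]`. [folklore] -/
theorem chartExponent_eq_add (hs : IsRoot q s₀) (W : ForcedWalk q s₀) (t : ℕ) {o s : ℕ}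
    (ho : ordZero (W.st t).F = o) (hos : o = s + (W.st t).r.degree) {d : Fin 3 →₀ ℕ} (hd : d ∈ (W.st t).F.support) :
    chartExponent q (W.j t) d =
      (Finsupp.erase (W.j t) (W.st t).r + Finsupp.single (W.j t) (o - q)) +
        chartExponent s (W.j t) (d - (W.st t).r) := by
  classical
  have hrd : (W.st t).r ≤ d := walk_r hs W t d hd
  have hod : o ≤ d.degree := ord_le_degree_of_mem_support W t ho hd
  have hqo : q ≤ o := by
    have h := walk_ord hs W t
    rw [ho] at h
    exact_mod_cast h
  have hsplit : (W.st t).r + (d - (W.st t).r) = d := add_tsub_cancel_of_le hrd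
  have hdegsplit : (W.st t).r.degree + (d - (W.st t).r).degree = d.degree := by
    have := congrArg Finsupp.degree hsplit
    rwa [map_add] at this
  ext i
  simp only [Finsupp.add_apply]
  by_cases hij : i = W.j t
  · rw [hij, chartExponent_self, chartExponent_self, Finsupp.erase_same, Finsupp.single_eq_same]
    omega
  · have h1 : chartExponent q (W.j t) d i = d i := by
      have := congrArg (fun c : Fin 3 →₀ ℕ => c i) (chartExponent_erase q (W.j t) d)
      simp only [Finsupp.erase_ne hij] at this
      exact this
    have h2 : chartExponent s (W.j t) (d - (W.st t).r) i = (d - (W.st t).r) i := by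
      have := congrArg (fun c : Fin 3 →₀ ℕ => c i) (chartExponent_erase s (W.j t) (d - (W.st t).r))
      simp only [Finsupp.erase_ne hij] at this
      exact this
    rw [h1, h2, Finsupp.erase_ne hij, Finsupp.single_eq_of_ne hij, Finsupp.tsub_apply]
    have := hrd i
    omega

/-- **THE FACTORISATION OF THE CHART TRANSFORM (PROVED):** `chartTransform q j F_t = u^A · Q` with `A = r off j + (o
− q)·e_j` and
`Q = Σ_d c_d · u^{(d − r)[j ↦ |d − r| − s]}` (the `s`-chart transform of `G = F/u^r`). [folklore] -/
theorem chartTransform_eq_monomial_mul (hs : IsRoot q s₀) (W : ForcedWalk q s₀) (t : ℕ) {o s : ℕ}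
    (ho : ordZero (W.st t).F = o) (hos : o = s + (W.st t).r.degree) :
    chartTransform q (W.j t) (W.st t).F =
      monomial (Finsupp.erase (W.j t) (W.st t).r + Finsupp.single (W.j t) (o - q)) (1 : K) *
        ∑ d ∈ (W.st t).F.support, monomial (chartExponent s (W.j t) (d - (W.st t).r)) (coeff d (W.st t).F) := by
  classical
  unfold chartTransform
  rw [Finset.mul_sum]
  refine Finset.sum_congr rfl fun d hd => ?_
  rw [monomial_mul, one_mul, ← chartExponent_eq_add hs W t ho hos hd]

/-- **THE MONOMIALS OF `Ψ̃ = translate b Q` (PROVED):** each lies below the `s`-chart exponent of some `d − r`, with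
equality in the
coordinate `j` — hence the U-FREE LAYER BOUND `σ_j(ψ) ≤ s + ψ_j`. [new] [folklore] -/
theorem psi_support (hs : IsRoot q s₀) (W : ForcedWalk q s₀) (t : ℕ) {o s : ℕ}
    (ho : ordZero (W.st t).F = o) (hos : o = s + (W.st t).r.degree) {ψ : Fin 3 →₀ ℕ}
    (hψ : ψ ∈ (PointBlowup.translate (W.b t)
      (∑ d ∈ (W.st t).F.support, monomial (chartExponent s (W.j t) (d - (W.st t).r)) (coeff d (W.st t).F))).support) :
    (Finsupp.erase (W.j t) ψ).degree ≤ s + ψ (W.j t) := by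
  classical
  have h0 := mem_support_iff.mp hψ
  rw [translate_finset_sum, coeff_sum] at h0
  obtain ⟨d, hd, hne⟩ := Finset.exists_ne_zero_of_sum_ne_zero h0
  have hle : ψ ≤ chartExponent s (W.j t) (d - (W.st t).r) := le_of_coeff_translate_monomial_ne_zero _ hne
  have hj : ψ (W.j t) = (chartExponent s (W.j t) (d - (W.st t).r)) (W.j t) :=
    apply_eq_of_coeff_translate_monomial_ne_zero _ (W.onExc t) hne
  rw [chartExponent_self] at hj
  have hrd : (W.st t).r ≤ d := walk_r hs W t d hd
  have hod : o ≤ d.degree := ord_le_degree_of_mem_support W t ho hd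
  have hdegsplit : (W.st t).r.degree + (d - (W.st t).r).degree = d.degree := by
    have := congrArg Finsupp.degree (add_tsub_cancel_of_le hrd)
    rwa [map_add] at this
  have h1 : Finsupp.erase (W.j t) ψ ≤ Finsupp.erase (W.j t) (d - (W.st t).r) := by
    intro i
    by_cases hij : i = W.j t
    · rw [hij, Finsupp.erase_same, Finsupp.erase_same]
    · rw [Finsupp.erase_ne hij, Finsupp.erase_ne hij]
      have := hle i
      have h2 : chartExponent s (W.j t) (d - (W.st t).r) i = (d - (W.st t).r) i := by
        have := congrArg (fun c : Fin 3 →₀ ℕ => c i) (chartExponent_erase s (W.j t) (d - (W.st t).r))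
        simp only [Finsupp.erase_ne hij] at this
        exact this
      omega
  have h3 := degree_le_degree_of_le h1
  have h4 := degree_erase_add (d - (W.st t).r) (W.j t)
  omega

end Layer

end Summit.ResolutionOfSingularities.ResolutionOfSingularities.Theorems.WallCutRun
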